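import Mathlib
import Summits.Ventures.PercRepro2.SwOutCrossSlab
import Summits.Ventures.PercRepro2.SwOutCrossCore

/-!
# THE ABSTRACT THEOREM OF BOUNDARY (iv), k = 2 pure: the rigid inequality on every up-set of
types of the cross-arm cube (blind cell PercRepro2, night-4 g23, 2026-08-28;
proofs/NIGHT4-G23.md §6)

**`card_le_crossArm`**: for every up-set `𝒯` of types (`IsUpT`) and every up-set `𝓔` of atom sets,
`#{q ∈ QX 𝒯 : ER q ∈ 𝓔} ≤ #{q ∈ QX 𝒯 : EB q ∈ 𝓔}`.  THE PROOF splits the non-leaking points: a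
non-core point has all u-arms red (T-slab) or all blue (B-slab) — at a mixed `s` the two-sided leak
constraints force the core (`Fib.core_of_noLeak`); on the T-slab `EB = ∅`, on the B-slab `ER = ∅`,
so (with `∅ ∉ 𝓔`) the slab points are counted on one side each and the injection `Fib.psi` (twelve
fibre points, `SwOutCrossSlab`) carries the T-slab count into the B-slab count; the core points are
counted by the cube principle over the u-arm cube, fibre by fibre, with the rearrangement of
`SwOutCrossCore` (`core_card_le`).  This is the several-arms big-block lemma of g21 with the
closure hypothesis (AL⁺) replaced by the TYPE ORDER, for a dropped component of two vertices with
a cross edge — the hypothesis the geometry satisfies (census: every pulled-back conditioning is an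
up-set of types).
-/

namespace Summit.Ventures.PercRepro2

namespace CrossArm

open LocRows

variable {ι : Type*}

open scoped Classical

section Slabs

/-- All u-arms red. -/
def sTop : Config ι := fun _ => true

/-- All u-arms blue. -/
def sBot : Config ι := fun _ => false

variable [Nonempty ι]

/-- `u` is red at the top. -/
lemma redU_top : redU (sTop : Config ι) := ⟨Classical.arbitrary ι, rfl⟩

/-- `u` is blue at the bottom. -/
lemma blueU_bot : blueU (sBot : Config ι) := ⟨Classical.arbitrary ι, rfl⟩

omit [Nonempty ι] in
/-- `u` is not red at the bottom. -/
lemma not_redU_bot : ¬ redU (sBot : Config ι) := fun ⟨_, hj⟩ => Bool.noConfusion hj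

omit [Nonempty ι] in
/-- The flip of the top is the bottom. -/
lemma flipAll_sTop : flipAll (sTop : Config ι) = sBot := rfl

omit [Nonempty ι] in
/-- The flip of the bottom is the top. -/
lemma flipAll_sBot : flipAll (sBot : Config ι) = sTop := rfl

omit [Nonempty ι] in
/-- At the bottom the red atoms are empty. -/
lemma ER_sBot (w : Fib) : ER ((sBot : Config ι), w) = ∅ := by
  ext a
  cases a with
  | arm j => exact ⟨fun h => Bool.noConfusion h, fun h => h.elim⟩
  | u => exact ⟨fun h => not_redU_bot h, fun h => h.elim⟩
  | p₁ => exact ⟨fun h => not_redU_bot h.1, fun h => h.elim⟩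
  | p₂ => exact ⟨fun h => not_redU_bot h.1, fun h => h.elim⟩
  | cross => exact ⟨fun h => not_redU_bot h.1, fun h => h.elim⟩

omit [Nonempty ι] in
/-- At the top the blue atoms are empty. -/
lemma EB_sTop (w : Fib) : EB ((sTop : Config ι), w) = ∅ := by
  rw [EB_eq, flipAll_sTop, ER_sBot]

omit [Nonempty ι] in
/-- A non-leaking non-core point has all u-arms red or all u-arms blue. -/
lemma top_or_bot_of_not_core {q : PtX ι} (hq : ¬ LeakX q) (hc : q.2.Core = false) :
    q.1 = sTop ∨ q.1 = sBot := by
  by_contra h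
  have hnt : q.1 ≠ sTop := fun h' => h (Or.inl h')
  have hnb : q.1 ≠ sBot := fun h' => h (Or.inr h')
  have hr : redU q.1 := by
    by_contra hr
    apply hnb
    funext j
    cases hj : q.1 j with
    | true => exact absurd ⟨j, hj⟩ hr
    | false => rfl
  have hb : blueU q.1 := by
    by_contra hb
    apply hnt
    funext j
    cases hj : q.1 j with
    | false => exact absurd ⟨j, hj⟩ hb
    | true => rfl
  have h1 : q.2.LeakR = false := by
    cases hL : q.2.LeakR with
    | false => rfl
    | true => exact absurd (Or.inl ⟨hr, hL⟩) hq
  have h2 : q.2.LeakB = false := by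
    cases hL : q.2.LeakB with
    | false => rfl
    | true => exact absurd (Or.inr ⟨hb, hL⟩) hq
  have := Fib.core_of_noLeak q.2 h1 h2
  rw [hc] at this
  exact Bool.noConfusion this

end Slabs

section Count

variable {𝒯 : Set (TypX ι)}

/-- Core points do not leak. -/
lemma not_leakX_of_core {q : PtX ι} (hc : q.2.Core = true) : ¬ LeakX q := by
  rintro (⟨-, h⟩ | ⟨-, h⟩)
  · rw [Fib.leakR_eq_false_of_core _ hc] at h; exact Bool.noConfusion h
  · rw [Fib.leakB_eq_false_of_core _ hc] at h; exact Bool.noConfusion h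

variable [Fintype ι] [DecidableEq ι]

/-- Membership in `QX`. -/
lemma mem_QX {q : PtX ι} : q ∈ QX 𝒯 ↔ ¬ LeakX q ∧ typX q ∈ 𝒯 := by
  simp only [QX, Finset.mem_filter, Finset.mem_univ, true_and]

/-- Counting the points of `QX` on a core fibre point `w` by their u-arm bits. -/
lemma card_core_fiber (w : Fib) (hw : w.Core = true) (R : Config ι → Prop) :
    ((QX 𝒯).filter fun q => q.2 = w ∧ R q.1).card =
      (Finset.univ.filter fun s => s ∈ D 𝒯 w ∧ R s).card := by
  refine Finset.card_bij' (fun q _ => q.1) (fun s _ => (s, w)) ?_ ?_ ?_ ?_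
  · intro q hq
    simp only [Finset.mem_filter, mem_QX] at hq
    simp only [Finset.mem_filter, Finset.mem_univ, true_and, D, Set.mem_setOf_eq]
    obtain ⟨⟨-, ht⟩, hw', hR⟩ := hq
    refine ⟨?_, hR⟩
    simpa [typX, hw'] using ht
  · intro s hs
    simp only [Finset.mem_filter, Finset.mem_univ, true_and, D, Set.mem_setOf_eq] at hs
    exact Finset.mem_filter.2 ⟨mem_QX.2 ⟨not_leakX_of_core hw, hs.1⟩, rfl, hs.2⟩
  · intro q hq
    simp only [Finset.mem_filter] at hq
    exact Prod.ext rfl hq.2.1.symm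
  · intro s _
    rfl

/-- The four core fibre points as a finset. -/
def coreFibs : Finset Fib := {wa, wb, wd, wf}

/-- A core fibre point lies in `coreFibs`. -/
lemma mem_coreFibs_of_core {w : Fib} (hw : w.Core = true) : w ∈ coreFibs := by
  rcases Fib.eq_of_core w hw with rfl | rfl | rfl | rfl <;> simp [coreFibs]

/-- The core count of a predicate, fibre by fibre. -/
lemma card_core_eq (P : PtX ι → Prop) :
    ((QX 𝒯).filter fun q => P q ∧ q.2.Core = true).card =
      ((QX 𝒯).filter fun q => q.2 = wa ∧ P q).card +
        ((QX 𝒯).filter fun q => q.2 = wb ∧ P q).card +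
        ((QX 𝒯).filter fun q => q.2 = wd ∧ P q).card +
        ((QX 𝒯).filter fun q => q.2 = wf ∧ P q).card := by
  rw [Finset.card_eq_sum_card_fiberwise (f := Prod.snd) (t := coreFibs)
    (fun q hq => mem_coreFibs_of_core (Finset.mem_filter.1 hq).2.2)]
  have hab : wa ≠ wb := by decide
  have had : wa ≠ wd := by decide
  have haf : wa ≠ wf := by decide
  have hbd : wb ≠ wd := by decide
  have hbf : wb ≠ wf := by decide
  have hdf : wd ≠ wf := by decide
  simp only [coreFibs]
  rw [Finset.sum_insert (by simp [hab, had, haf]), Finset.sum_insert (by simp [hbd, hbf]),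
    Finset.sum_insert (by simp [hdf]), Finset.sum_singleton]
  have key : ∀ w : Fib, w.Core = true →
      (((QX 𝒯).filter fun q => P q ∧ q.2.Core = true).filter fun q => q.2 = w) =
        (QX 𝒯).filter fun q => q.2 = w ∧ P q := by
    intro w hw
    rw [Finset.filter_filter]
    apply Finset.filter_congr
    intro q _
    constructor
    · rintro ⟨⟨hP, -⟩, hq⟩; exact ⟨hq, hP⟩
    · rintro ⟨hq, hP⟩; exact ⟨⟨hP, hq ▸ hw⟩, hq⟩
  rw [key wa wa_core, key wb wb_core, key wd wd_core, key wf wf_core]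
  ring

/-- The red core count on a core fibre point, as a count over the u-arm cube. -/
lemma card_core_ER (𝓔 : Set (Set (AtomX ι))) (w : Fib) (hw : w.Core = true) :
    ((QX 𝒯).filter fun q => q.2 = w ∧ ER q ∈ 𝓔).card =
      (Finset.univ.filter (· ∈ D 𝒯 w ∩ A 𝓔 w)).card := by
  have h := card_core_fiber (𝒯 := 𝒯) w hw (fun s => ER (s, w) ∈ 𝓔)
  have e1 : ((QX 𝒯).filter fun q => q.2 = w ∧ ER q ∈ 𝓔) =
      (QX 𝒯).filter fun q => q.2 = w ∧ ER (q.1, w) ∈ 𝓔 := by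
    apply Finset.filter_congr
    intro q _
    constructor
    · rintro ⟨hq, hE⟩
      have hqw : q = (q.1, w) := Prod.ext rfl hq
      exact ⟨hq, by rw [hqw] at hE; exact hE⟩
    · rintro ⟨hq, hE⟩
      have hqw : q = (q.1, w) := Prod.ext rfl hq
      exact ⟨hq, by rw [hqw]; exact hE⟩
  have e2 : (Finset.univ.filter fun s => s ∈ D 𝒯 w ∧ ER (s, w) ∈ 𝓔) =
      Finset.univ.filter (· ∈ D 𝒯 w ∩ A 𝓔 w) := by
    apply Finset.filter_congr
    intro s _
    exact Iff.rfl
  rw [e1, h, e2]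

/-- The blue core count on a core fibre point, as a count over the u-arm cube (the flipped fibre). -/
lemma card_core_EB (𝓔 : Set (Set (AtomX ι))) (w : Fib) (hw : w.Core = true) :
    ((QX 𝒯).filter fun q => q.2 = w ∧ EB q ∈ 𝓔).card =
      (Finset.univ.filter (· ∈ D 𝒯 w ∩ Fl 𝓔 w.flip)).card := by
  have h := card_core_fiber (𝒯 := 𝒯) w hw (fun s => EB (s, w) ∈ 𝓔)
  have e1 : ((QX 𝒯).filter fun q => q.2 = w ∧ EB q ∈ 𝓔) =
      (QX 𝒯).filter fun q => q.2 = w ∧ EB (q.1, w) ∈ 𝓔 := by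
    apply Finset.filter_congr
    intro q _
    constructor
    · rintro ⟨hq, hE⟩
      have hqw : q = (q.1, w) := Prod.ext rfl hq
      exact ⟨hq, by rw [hqw] at hE; exact hE⟩
    · rintro ⟨hq, hE⟩
      have hqw : q = (q.1, w) := Prod.ext rfl hq
      exact ⟨hq, by rw [hqw]; exact hE⟩
  have e2 : (Finset.univ.filter fun s => s ∈ D 𝒯 w ∧ EB (s, w) ∈ 𝓔) =
      Finset.univ.filter (· ∈ D 𝒯 w ∩ Fl 𝓔 w.flip) := by
    apply Finset.filter_congr
    intro s _
    exact Iff.rfl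
  rw [e1, h, e2]

/-- Splitting a count of `QX` into the core, the T-slab and the B-slab. -/
lemma card_split [Nonempty ι] (P : PtX ι → Prop) :
    ((QX 𝒯).filter fun q => P q).card =
      ((QX 𝒯).filter fun q => P q ∧ q.2.Core = true).card +
        ((QX 𝒯).filter fun q => P q ∧ q.2.Core = false ∧ q.1 = sTop).card +
        ((QX 𝒯).filter fun q => P q ∧ q.2.Core = false ∧ q.1 = sBot).card := by
  have h1 := Finset.card_filter_add_card_filter_not (s := (QX 𝒯).filter fun q => P q)
    (fun q => q.2.Core = true)
  have h2 := Finset.card_filter_add_card_filter_not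
    (s := (QX 𝒯).filter fun q => P q ∧ ¬ q.2.Core = true) (fun q => q.1 = sTop)
  simp only [Finset.filter_filter] at h1 h2
  have e1 : ((QX 𝒯).filter fun q => (P q ∧ ¬ q.2.Core = true) ∧ q.1 = sTop) =
      (QX 𝒯).filter fun q => P q ∧ q.2.Core = false ∧ q.1 = sTop := by
    apply Finset.filter_congr
    intro q _
    constructor
    · rintro ⟨⟨hP, hc⟩, ht⟩
      have hc' : q.2.Core = false := by cases h : q.2.Core <;> simp_all
      exact ⟨hP, hc', ht⟩
    · rintro ⟨hP, hc, ht⟩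
      exact ⟨⟨hP, fun h => by rw [hc] at h; exact Bool.noConfusion h⟩, ht⟩
  have e2 : ((QX 𝒯).filter fun q => (P q ∧ ¬ q.2.Core = true) ∧ ¬ q.1 = sTop) =
      (QX 𝒯).filter fun q => P q ∧ q.2.Core = false ∧ q.1 = sBot := by
    apply Finset.filter_congr
    intro q hq
    constructor
    · rintro ⟨⟨hP, hc⟩, ht⟩
      have hc' : q.2.Core = false := by cases h : q.2.Core <;> simp_all
      rcases top_or_bot_of_not_core (mem_QX.1 hq).1 hc' with h | h
      · exact absurd h ht
      · exact ⟨hP, hc', h⟩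
    · rintro ⟨hP, hc, hb⟩
      refine ⟨⟨hP, fun h => by rw [hc] at h; exact Bool.noConfusion h⟩, fun ht => ?_⟩
      have := congrFun (hb.symm.trans ht) (Classical.arbitrary ι)
      exact Bool.noConfusion this
  rw [e1, e2] at h2
  omega

/-- **The slab injection**: the red T-slab count is at most the blue B-slab count. -/
lemma card_slab_le [Nonempty ι] (h𝒯 : IsUpT 𝒯) {𝓔 : Set (Set (AtomX ι))} (h𝓔 : IsUpperSet 𝓔) :
    ((QX 𝒯).filter fun q => ER q ∈ 𝓔 ∧ q.2.Core = false ∧ q.1 = sTop).card ≤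
      ((QX 𝒯).filter fun q => EB q ∈ 𝓔 ∧ q.2.Core = false ∧ q.1 = sBot).card := by
  refine Finset.card_le_card_of_injOn (fun q => ((sBot : Config ι), q.2.psi)) ?_ ?_
  · intro q hq
    rw [Finset.mem_coe, Finset.mem_filter, mem_QX] at hq
    obtain ⟨⟨hnl, ht⟩, hE, hc, hs⟩ := hq
    have hR : q.2.LeakR = false := by
      cases hL : q.2.LeakR with
      | false => rfl
      | true => exact absurd (Or.inl ⟨hs ▸ redU_top, hL⟩) hnl
    obtain ⟨hB, hc', hl, h₁, h₂, hC⟩ := Fib.psi_ok q.2 hR hc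
    rw [Finset.mem_coe, Finset.mem_filter, mem_QX]
    refine ⟨⟨?_, ?_⟩, ?_, hc', rfl⟩
    · rintro (⟨h, -⟩ | ⟨-, h⟩)
      · exact not_redU_bot h
      · rw [hB] at h; exact Bool.noConfusion h
    · refine h𝒯 _ ht _ ⟨fun j hj => ?_, hl⟩
      have hj' : q.1 j = false := hj
      rw [hs] at hj'
      exact Bool.noConfusion hj'
    · rw [EB_eq, flipAll_sBot]
      refine h𝓔 ?_ hE
      have hqw : q = (sTop, q.2) := Prod.ext hs rfl
      rw [hqw]
      exact ER_mono_fib _ h₁ h₂ hC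
  · intro q hq q' hq' heq
    rw [Finset.mem_coe, Finset.mem_filter, mem_QX] at hq hq'
    have heq' : q.2.psi = q'.2.psi := (Prod.mk.inj heq).2
    obtain ⟨⟨hnl, -⟩, -, hc, hs⟩ := hq
    obtain ⟨⟨hnl', -⟩, -, hc', hs'⟩ := hq'
    have hR : q.2.LeakR = false := by
      cases hL : q.2.LeakR with
      | false => rfl
      | true => exact absurd (Or.inl ⟨hs ▸ redU_top, hL⟩) hnl
    have hR' : q'.2.LeakR = false := by
      cases hL : q'.2.LeakR with
      | false => rfl
      | true => exact absurd (Or.inl ⟨hs' ▸ redU_top, hL⟩) hnl'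
    exact Prod.ext (hs.trans hs'.symm) (Fib.psi_inj _ _ hR hc hR' hc' heq')

/-- **THE ABSTRACT THEOREM OF BOUNDARY (iv), k = 2 PURE**: on every up-set of types of the
cross-arm cube, the red count is at most the blue count for every up-set of atom sets. -/
theorem card_le_crossArm [Nonempty ι] (h𝒯 : IsUpT 𝒯) {𝓔 : Set (Set (AtomX ι))} (h𝓔 : IsUpperSet 𝓔) :
    ((QX 𝒯).filter fun q => ER q ∈ 𝓔).card ≤ ((QX 𝒯).filter fun q => EB q ∈ 𝓔).card := by
  by_cases hE : (∅ : Set (AtomX ι)) ∈ 𝓔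
  · have hall : ∀ A : Set (AtomX ι), A ∈ 𝓔 := fun A => h𝓔 (Set.empty_subset A) hE
    rw [Finset.filter_true_of_mem fun _ _ => hall _, Finset.filter_true_of_mem fun _ _ => hall _]
  rw [card_split (𝒯 := 𝒯) (fun q => ER q ∈ 𝓔), card_split (𝒯 := 𝒯) (fun q => EB q ∈ 𝓔)]
  -- the B-slab carries no red, the T-slab no blue
  have hB0 : ((QX 𝒯).filter fun q => ER q ∈ 𝓔 ∧ q.2.Core = false ∧ q.1 = sBot).card = 0 := by
    rw [Finset.card_eq_zero, Finset.filter_eq_empty_iff]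
    rintro q - ⟨hE', -, hs⟩
    apply hE
    have : ER q = ∅ := by
      rw [show q = (q.1, q.2) from rfl, hs]
      exact ER_sBot q.2
    rw [this] at hE'
    exact hE'
  have hT0 : ((QX 𝒯).filter fun q => EB q ∈ 𝓔 ∧ q.2.Core = false ∧ q.1 = sTop).card = 0 := by
    rw [Finset.card_eq_zero, Finset.filter_eq_empty_iff]
    rintro q - ⟨hE', -, hs⟩
    apply hE
    have : EB q = ∅ := by
      rw [show q = (q.1, q.2) from rfl, hs]
      exact EB_sTop q.2
    rw [this] at hE'
    exact hE'
  -- the core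
  have hcore : ((QX 𝒯).filter fun q => ER q ∈ 𝓔 ∧ q.2.Core = true).card ≤
      ((QX 𝒯).filter fun q => EB q ∈ 𝓔 ∧ q.2.Core = true).card := by
    rw [card_core_eq, card_core_eq, card_core_ER 𝓔 wa wa_core, card_core_ER 𝓔 wb wb_core,
      card_core_ER 𝓔 wd wd_core, card_core_ER 𝓔 wf wf_core, card_core_EB 𝓔 wa wa_core,
      card_core_EB 𝓔 wb wb_core, card_core_EB 𝓔 wd wd_core, card_core_EB 𝓔 wf wf_core]
    exact core_card_le h𝒯 h𝓔
  have hslab := card_slab_le h𝒯 h𝓔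
  omega

end Count

end CrossArm

end Summit.Ventures.PercRepro2
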